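import Summits.BirchSwinnertonDyer.Rank1Residual.X11b.BDPRouteTamagawaDefect
import Summits.BirchSwinnertonDyer.Rank1Residual.AdditivePotMult.TwistSupplyJ
import HarnessLib

/-!
# Rank ONE at a BAD (in particular ADDITIVE) prime: base change to an imaginary quadratic field in
# which `p` SPLITS, and descent — Kolyvagin's Tamagawa-defect inequality RELATIVE to the lower half of
# the rank-zero Heegner twist

HONEST FRAMING (cell `b2b-bsdres`, run/shared/lean/b2b/bsd-rank1-residual/, verbatim in every
file): the goal of the cell is to DELETE the COMBINATION-SHAPED residual classes of the
Birch–Swinnerton-Dyer formula for ALL analytic-rank `≤ 1` elliptic curves over `ℚ` — "full BSD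
formula for every rank `≤ 1` curve in class `C`" assembled STRICTLY from published theorems — so
that the rank-`≤ 1` remainder becomes exactly the CONSTRUCTION-SHAPED classes, which are TYPED
(missing-input `Prop`s), NOT attempted. This is not "finishing BSD". Sub-cell
`b2b-bsdres-additive-p1` (CLASS-OWNERS row "X3/X4 additive — pot. multiplicative / X3♯(M)"),
generation 4; research route, no claim beyond the stated sub-classes; X4 and X4(M) REMAIN
CONSTRUCTION-SHAPED; nothing is booked.

Theorems only; no definition, no new named fact. The sub-cell's second base change. Generations 0–4
relocated `BSD(E,p)` for `(E,p) ∈ X3♯(M)/X4(M)` to a quadratic field RAMIFIED at `p` (over which `E`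
becomes multiplicative above `p`). Here the auxiliary field is an imaginary quadratic `K` satisfying
the Heegner hypothesis for `N_E` — `p ∣ N_E` SPLITS in `K`, `E_K` stays additive above `p` — and the
`p`-part theorem over `K` that exists in print REGARDLESS of the reduction type at `p` is Kolyvagin's:
`ord_p #Ш(E/K) ≤ 2·ord_p [E(K) : ℤ y_K]` for `p` odd with `ρ̄_{E,p}` onto (McCallum 1991 §1 Theorem,
tree named fact `Kolyvagin1990_padicValNat_card_sha_le` — NO hypothesis at `p` beyond `p` odd and
surjectivity), with the index computed by Gross–Zagier (`gross_zagier`, `kolyvagin`). The descent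
(`#Ш(E_K) = #Ш(E)·#Ш(E^{(d_K)})` at odd `p`, period/Tamagawa/Manin bookkeeping) is multr1-p2's
class-agnostic core `X11b.padicValNat_shaOrder_le_add_of_shaIndexBound` (Jetchev–Skinner–Wan 2017
§7.4.2), which this file feeds at a BAD prime of any type:

* §1 `padicValRat_u_eq_zero_of_twist_minimal_of_dvd` — x11b's transport (e) (`ord_p u = 0` for the
  minimal model of the twist by `d_K`) with "multiplicative at `p`" weakened to "`p ∣ N`" (all its
  proof uses; adapted verbatim); `good_iff_of_twist`, `addv_iff_of_twist` — good/additive reduction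
  is invariant under a twist by an `ℓ`-adic square (companions of x11b's `mult_iff_of_twist`).
* §2 `exists_printShape_lower_of_missingLowerBoundAt_rankZero` — the cell's `MissingLowerBoundAt`
  in the print shape `ord_p(L(1)/Ω) ≤ ord_p(#Ш ∏c/#tors²)` (rank `0`, `E[p]` irreducible).
* §3 **`padicValNat_shaOrder_le_add_of_heegnerData_of_lowerTwist`** — at fixed Heegner data
  (`K`, parametrisation datum `D` with `p ∤ c(D)` — a HYPOTHESIS at an additive `p`, where Mazur
  1978 Cor. 4.1 is unavailable —, Heegner datum, `K`-rational Heegner point, minimal twist model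
  `Wd`, a Kolyvagin-shape bound): `ord_{s=1} L(E,s) = 1`, `p ≥ 5`, `p ∣ N`, `E[p]` irreducible,
  `L(E^{(d_K)},1) ≠ 0`, and the LOWER half `MissingLowerBoundAt Wd p` of the RANK-ZERO twist ⟹
  `#Ш(E)_an = q ∈ ℚ` with `ord_p #Ш(E) ≤ ord_p q + 2·ord_p ∏_ℓ c_ℓ(E)`. At a multiplicative `p`
  with (ram) the twist's lower half is Skinner 2016 Thm. C and this is multr1-p2's theorem; at an
  additive `p` the twist is ANOTHER additive pair with the same `j` (an X4 pair of analytic rank `0`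
  when `E[p]` is irreducible) and its lower half is exactly what the cell types as missing.

The class-level forms (Friedberg–Hoffstein twist supply, Gross–Darmon Heegner point, the X4(M)
specialisation through this sub-cell's relocation) are in `RankOneHeegnerClass.lean`.
-/

noncomputable section

open scoped Classical NumberField

open WeierstrassCurve NumberField Literature.NumberTheory.EllipticCurves
  Literature.NumberTheory.EllipticCurves.ModularForms
  Literature.NumberTheory.EllipticCurves.Rank1Residual
  Literature.NumberTheory.EllipticCurves.Rank1Residual.Typed
  Literature.NumberTheory.Automorphic
  IsDedekindDomain

namespace Summit.BirchSwinnertonDyer.Rank1Residual.AdditivePotMult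

/-! ### §1 Transports along the twist by a Heegner field at a BAD prime `p` (multiplicative OR additive) -/

/-- **`ord_p u = 0` for the minimal model of the twist by a Heegner field, at ANY bad prime `p`**
(x11b's `padicValRat_u_eq_zero_of_twist_minimal` with its hypothesis "multiplicative at `p`" replaced
by "`p ∣ N`", which is all its proof uses: `d_K` is then a `p`-adic unit square, the two globally
minimal equations are `ℤ_p`-minimal and `ℚ_p`-isomorphic, so `v_p(Δ(Wd)) = v_p(Δ(W))`, and
`Δ(Wd) = u⁻¹² d_K⁶ Δ(W)`). Proof adapted verbatim from `X11b/TwistTransportUnit.lean` (multr1-p2).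
[cite: SilvermanAEC2009, VII.1 Prop. 1.3(b) and X.5 Cor. 5.4] -/
theorem padicValRat_u_eq_zero_of_twist_minimal_of_dvd (W : WeierstrassCurve ℚ) [W.IsElliptic]
    [W.IsGloballyMinimal] (p : ℕ) [Fact p.Prime] (K : Type) [Field K] [NumberField K]
    (hK : IsImaginaryQuadratic K) (hH : SatisfiesHeegnerHypothesis (W.conductorNorm ℤ) K)
    (hpN : p ∣ W.conductorNorm ℤ) {Wd : WeierstrassCurve ℚ} [Wd.IsElliptic]
    [Wd.IsGloballyMinimal] (Cd : VariableChange ℚ)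
    (hWd : Cd • W.quadraticTwist (NumberField.discr K : ℚ) = Wd) :
    padicValRat p (Cd.u : ℚ) = 0 := by
  -- adapted from Summits/BirchSwinnertonDyer/Rank1Residual/X11b/TwistTransportUnit.lean
  have hp : p.Prime := Fact.out
  set d : ℚ := (NumberField.discr K : ℚ) with hd_def
  have hD0 : d ≠ 0 := by rw [hd_def]; exact_mod_cast NumberField.discr_ne_zero K
  haveI : (W.baseChange ℚ_[p]).IsElliptic :=
    inferInstanceAs (W.map (algebraMap ℚ ℚ_[p])).IsElliptic
  haveI : (W.quadraticTwist d).IsElliptic := W.isElliptic_quadraticTwist hD0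
  have hsq : IsSquare (algebraMap ℚ ℚ_[p] d) := X11b.isSquare_discr_padic_of_heegner K hK hH p hpN
  have hpd : ¬ (p : ℤ) ∣ NumberField.discr K :=
    Literature.SatisfiesHeegnerHypothesis.not_dvd_discr hK.1 hH hp hpN
  obtain ⟨θ, hθ⟩ := hsq
  have hθ0 : θ ≠ 0 := by
    rintro rfl
    exact (map_ne_zero (algebraMap ℚ ℚ_[p])).mpr hD0 (hθ.trans (mul_zero 0))
  set X : WeierstrassCurve ℚ_[p] := W.baseChange ℚ_[p] with hX
  set Y : WeierstrassCurve ℚ_[p] := Wd.baseChange ℚ_[p] with hY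
  haveI hXmin : X.IsMinimal ℤ_[p] := isMinimal_map_padic_of_isGloballyMinimal W p
  haveI hYmin : Y.IsMinimal ℤ_[p] := isMinimal_map_padic_of_isGloballyMinimal Wd p
  obtain ⟨C, hC⟩ := (W.baseChange ℚ_[p]).exists_variableChange_smul_eq_quadraticTwist_sq hθ0
  have h1 : (W.quadraticTwist d).baseChange ℚ_[p] = C • X := by
    rw [hC, baseChange, baseChange, map_quadraticTwist, hθ, sq]
  have hYX : Y = (Cd.map (algebraMap ℚ ℚ_[p]) * C) • X := by
    rw [hY, ← hWd, WeierstrassCurve.VariableChange.baseChange_smul_eq (W.quadraticTwist d) Cd ℚ_[p],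
      h1, mul_smul]
  set V := (IsDiscreteValuationRing.maximalIdeal ℤ_[p]).valuation ℚ_[p] with hV
  have hval : V Y.Δ = V X.Δ := valuation_Δ_eq_of_isMinimal_of_eq_smul ℤ_[p] hYX
  have hΔd : Wd.Δ = (↑Cd.u⁻¹ : ℚ) ^ 12 * (d ^ 6 * W.Δ) := by
    rw [← hWd, variableChange_Δ, quadraticTwist_Δ]
  have hYΔ : Y.Δ = algebraMap ℚ ℚ_[p] Wd.Δ := by rw [hY, baseChange, map_Δ]
  have hXΔ : X.Δ = algebraMap ℚ ℚ_[p] W.Δ := by rw [hX, baseChange, map_Δ]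
  rw [hYΔ, hXΔ, hΔd] at hval
  simp only [map_mul, map_pow] at hval
  have hΔ0 : V (algebraMap ℚ ℚ_[p] W.Δ) ≠ 0 :=
    (Valuation.ne_zero_iff V).mpr ((map_ne_zero _).mpr W.isUnit_Δ.ne_zero)
  have hvd : V (algebraMap ℚ ℚ_[p] d) = 1 := by
    have : algebraMap ℚ ℚ_[p] d = ((NumberField.discr K : ℤ) : ℚ_[p]) := by
      rw [hd_def, map_intCast]
    rw [this]
    exact X11b.valuation_maximalIdeal_intCast_eq_one p hpd
  rw [hvd, one_pow, one_mul, mul_left_eq_self₀] at hval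
  have hu12 : V (algebraMap ℚ ℚ_[p] (↑Cd.u⁻¹ : ℚ)) ^ 12 = 1 := hval.resolve_right hΔ0
  have hu1 : V (algebraMap ℚ ℚ_[p] (↑Cd.u⁻¹ : ℚ)) = 1 :=
    (pow_eq_one_iff_left (by norm_num)).mp hu12
  have hu : V ((Cd.u : ℚ) : ℚ_[p]) = 1 := by
    rw [Units.val_inv_eq_inv_val, map_inv₀, map_inv₀, inv_eq_one] at hu1
    rw [← hu1, eq_ratCast]
  exact X11b.padicValRat_eq_zero_of_valuation_eq_one p (Cd.u.ne_zero) hu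

variable {W : WeierstrassCurve ℚ} [W.IsElliptic] {p : ℕ} [Fact p.Prime]

omit [W.IsElliptic] in
/-- **Good reduction at `ℓ` is invariant under a twist by an `ℓ`-adic square** (the companion of
x11b's `mult_iff_of_twist`): for `Wd = C • W^{(d)}` with `d ∈ (ℚ_ℓ^×)²`, `Good Wd ℓ ↔ Good W ℓ` —
the chosen `ℤ_ℓ`-minimal equations of the two `ℚ_ℓ`-isomorphic curves are related by a change of
variables (`X11b.exists_baseChange_eq_smul_of_twist`) and good reduction of a minimal equation is
`v(Δ) = 0` (tree `hasGoodReduction_iff_of_isMinimal_of_eq_smul`, Silverman *AEC* VII.5.1(a)).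
[cite: SilvermanAEC2009, VII.5 Prop. 5.1(a) and X.5 Cor. 5.4] -/
theorem good_iff_of_twist {d : ℚ} (hd : d ≠ 0) {ℓ : ℕ} [Fact ℓ.Prime]
    (hsq : IsSquare ((d : ℚ) : ℚ_[ℓ])) (Wd : WeierstrassCurve ℚ) [Wd.IsElliptic]
    {C : VariableChange ℚ} (hC : C • W.quadraticTwist d = Wd) :
    Good Wd ℓ ↔ Good W ℓ := by
  obtain ⟨D, hD⟩ := X11b.exists_baseChange_eq_smul_of_twist W hd hsq Wd hC
  unfold Good HasGoodReductionAtPrime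
  set X : WeierstrassCurve ℚ_[ℓ] := W.baseChange ℚ_[ℓ] with hX
  set Y : WeierstrassCurve ℚ_[ℓ] := Wd.baseChange ℚ_[ℓ] with hY
  set D₁ : VariableChange ℚ_[ℓ] := (X.exists_isMinimal ℤ_[ℓ]).choose with hD₁
  set D₂ : VariableChange ℚ_[ℓ] := (Y.exists_isMinimal ℤ_[ℓ]).choose with hD₂
  have h₁ : X.minimal ℤ_[ℓ] = D₁ • X := rfl
  have h₂ : Y.minimal ℤ_[ℓ] = D₂ • Y := rfl
  have h : Y.minimal ℤ_[ℓ] = (D₂ * D * D₁⁻¹) • X.minimal ℤ_[ℓ] := by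
    rw [h₂, hD, h₁, mul_smul, mul_smul, inv_smul_smul]
  exact hasGoodReduction_iff_of_isMinimal_of_eq_smul ℤ_[ℓ] h

/-- **Additive reduction at `ℓ` is invariant under a twist by an `ℓ`-adic square**
(`good_iff_of_twist`, x11b's `mult_iff_of_twist`). [folklore] -/
theorem addv_iff_of_twist {d : ℚ} (hd : d ≠ 0) {ℓ : ℕ} [Fact ℓ.Prime]
    (hsq : IsSquare ((d : ℚ) : ℚ_[ℓ])) (Wd : WeierstrassCurve ℚ) [Wd.IsElliptic]
    {C : VariableChange ℚ} (hC : C • W.quadraticTwist d = Wd) :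
    Addv Wd ℓ ↔ Addv W ℓ := by
  unfold Addv
  rw [show Wd.HasGoodReductionAtPrime ℓ ↔ W.HasGoodReductionAtPrime ℓ from
      good_iff_of_twist hd hsq Wd hC,
    show Wd.HasMultiplicativeReductionAtPrime ℓ ↔ W.HasMultiplicativeReductionAtPrime ℓ from
      X11b.mult_iff_of_twist W hd hsq Wd hC]

/-! ### §2 The rank-zero lower half in print shape -/

/-- **From the cell's `MissingLowerBoundAt` to the print shape, rank `0`, `E[p]` irreducible.** For a
globally minimal `Wd` of analytic rank `0` with `Wd[p]` irreducible,
`MissingLowerBoundAt Wd p` (`#Ш_an = q ∈ ℚ`, `ord_p q ≤ ord_p #Ш`) gives `L(Wd,1)/Ω = q' ∈ ℚ` with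
`ord_p q' ≤ ord_p #Ш + ord_p ∏c_ℓ − 2 ord_p #tors` (bookkeeping: `L^{(0)}(1)/0! = L(1)`, `Reg = 1`,
`#Ш_an = L(1) #tors²/(Ω ∏c)`, `ord_p #tors = 0` by Mazur under (irr); granted GZK for `rank = 0`).
[cite: Miller2011LMS, §1 and Def. 1.1 (arXiv:1010.2431 p. 3)] -/
theorem exists_printShape_lower_of_missingLowerBoundAt_rankZero (Wd : WeierstrassCurve ℚ)
    [Wd.IsElliptic] [Wd.IsGloballyMinimal] (hGZK : rank_eq_analyticRank_of_analyticRank_le_one)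
    (hr0 : Wd.analyticRank = 0) (hirr : Irr Wd p) (hlow : MissingLowerBoundAt Wd p) :
    ∃ q : ℚ, Wd.entireLFunction 1 / (Wd.realPeriodRat : ℂ) = (q : ℂ) ∧
      padicValRat p q ≤ (padicValNat p Wd.shaOrder : ℤ) + padicValNat p Wd.tamagawaProduct -
        2 * padicValNat p Wd.torsionOrder := by
  obtain ⟨q, hq, hle⟩ := hlow
  have hrank : Wd.mordellWeilRank = 0 := by rw [(hGZK Wd (by rw [hr0]; exact zero_le_one)).1, hr0]
  have htors : padicValNat p Wd.torsionOrder = 0 :=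
    padicValNat_torsionOrder_eq_zero_of_irreducible Wd p hirr
  have hc : 0 < Wd.tamagawaProduct := Wd.tamagawaProduct_pos_holds
  have ht : 0 < Wd.torsionOrder := Wd.torsionOrder_pos_holds
  have hΩ : (Wd.realPeriodRat : ℂ) ≠ 0 := by exact_mod_cast Wd.realPeriodRat_pos_holds.ne'
  have htC : (Wd.torsionOrder : ℂ) ≠ 0 := by exact_mod_cast ht.ne'
  have hcC : (Wd.tamagawaProduct : ℂ) ≠ 0 := by exact_mod_cast hc.ne'
  -- `L(1) = #Ш_an · Ω · ∏c / #tors²`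
  have hsha := hq
  rw [shaAn_def, Wd.leadingLCoeff_eq_of_analyticRank_eq_zero hr0,
    Wd.regulator_eq_one_of_rank_zero hrank] at hsha
  refine ⟨q * (Wd.tamagawaProduct : ℚ) / (Wd.torsionOrder : ℚ) ^ 2, ?_, ?_⟩
  · have hL : Wd.entireLFunction 1 =
        (q : ℂ) * ((Wd.realPeriodRat : ℂ) * (Wd.tamagawaProduct : ℂ)) / (Wd.torsionOrder : ℂ) ^ 2 := by
      rw [← hsha]
      push_cast
      field_simp
    rw [hL]
    push_cast
    field_simp
  · by_cases hq0 : q = 0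
    · subst hq0
      simp only [zero_mul, zero_div, padicValRat.zero, htors, Nat.cast_zero, mul_zero, sub_zero]
      positivity
    · have htq : (Wd.torsionOrder : ℚ) ≠ 0 := by exact_mod_cast ht.ne'
      have hcq : (Wd.tamagawaProduct : ℚ) ≠ 0 := by exact_mod_cast hc.ne'
      rw [padicValRat.div (mul_ne_zero hq0 hcq) (pow_ne_zero 2 htq), padicValRat.mul hq0 hcq,
        padicValRat.pow, padicValRat.of_nat, padicValRat.of_nat, htors]
      simp only [Nat.cast_zero, mul_zero, sub_zero]
      omega

/-! ### §3 Data level: Kolyvagin's Tamagawa defect at a bad prime, relative to the twist's lower half -/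

/-- **Kolyvagin's Tamagawa defect at fixed Heegner data, at ANY bad prime `p ≥ 5` — relative form.**
Data: `W/ℚ` globally minimal of conductor `N` with `ord_{s=1} L(E,s) = 1`; a prime `p ≥ 5` with
`p ∣ N` (multiplicative OR additive), `E[p]` irreducible; `K` imaginary quadratic satisfying the
Heegner hypothesis for `N` (so `p` SPLITS in `K`), `p ∤ #𝓞_K^×`, `L(E^{(d_K)},1) ≠ 0`; a
parametrisation datum `Dt` at level `N` with Manin constant `p ∤ c` (a HYPOTHESIS at an additive
`p`, where Mazur 1978 Cor. 4.1 is not available), a Heegner datum `H`, `P ∈ E(K)` mapping to the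
complex Heegner point; `Wd` a globally minimal model of `E^{(d_K)}`; an upper bound of Kolyvagin's
shape over `K` (`hU`); and — the ONE non-published input — the LOWER half of `BSD(E^{(d_K)},p)`,
`MissingLowerBoundAt Wd p` (`hlow`; at a multiplicative `p` with (ram) this is Skinner 2016 Thm. C, as
in multr1-p2's `padicValNat_shaOrder_le_add_of_heegnerData`; at an additive `p` the twist is again
additive at `p` with the same `j`, an X4 pair of analytic rank `0`). CONCLUSION: `#Ш(E)_an = q ∈ ℚ`
with `ord_p #Ш(E) ≤ ord_p q + 2·ord_p ∏_ℓ c_ℓ(E)`. Proof: transports to `Wd` (irr: x11b's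
`hasIrreducibleModPGaloisRep_twist_model`; Tamagawa: x11b's `padicValNat_tamagawaProduct_twist_of_heegner`;
unit: `padicValRat_u_eq_zero_of_twist_minimal_of_dvd`), the print shape of `hlow` (§2), and
multr1-p2's class-agnostic core `X11b.padicValNat_shaOrder_le_add_of_shaIndexBound` (Gross–Zagier
`hGZ`, Kolyvagin `hKo`, GZK, modularity). [cite: McCallumLMS1991, §1 Theorem (Kolyvagin), p. 296]
[cite: JetchevSkinnerWan2017, §7.4.2 (p. 31)] [cite: Miller2011LMS, Def. 1.1] -/
theorem padicValNat_shaOrder_le_add_of_heegnerData_of_lowerTwist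
    (W : WeierstrassCurve ℚ) [W.IsElliptic] [W.IsGloballyMinimal] (p : ℕ) [Fact p.Prime]
    [NeZero (W.conductorNorm ℤ)] (K : Type) [Field K] [NumberField K]
    (Dt : ModularParametrizationData W (W.conductorNorm ℤ))
    (H : HeegnerDatum (W.conductorNorm ℤ) (NumberField.discr K)) (ι : K →+* ℂ)
    (P : (W.baseChange K).toAffine.Point)
    -- the published inputs (named facts of the tree)
    (hGZ : gross_zagier (W.conductorNorm ℤ) W K) (hKo : kolyvagin (W.conductorNorm ℤ) W K)
    (hGZK : rank_eq_analyticRank_of_analyticRank_le_one) (hmod : hasEntireLFunction_rat)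
    -- the pair
    (hr : W.analyticRank = 1) (hp5 : 5 ≤ p) (hpN : p ∣ W.conductorNorm ℤ) (hirr : Irr W p)
    -- the Heegner data
    (hK : IsImaginaryQuadratic K) (hHN : SatisfiesHeegnerHypothesis (W.conductorNorm ℤ) K)
    (hP : WeierstrassCurve.Affine.Point.map ι.toRatAlgHom P = heegnerPointComplex Dt H)
    (hc : ¬ (p : ℤ) ∣ Dt.c) (hμ : ¬ p ∣ Units.torsionOrder K)
    (hLt : (W.quadraticTwist (NumberField.discr K : ℚ)).entireLFunction 1 ≠ 0)
    (Wd : WeierstrassCurve ℚ) [Wd.IsElliptic] [Wd.IsGloballyMinimal] (Cd : VariableChange ℚ)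
    (hWd : Cd • W.quadraticTwist (NumberField.discr K : ℚ) = Wd)
    -- the ONE non-published input: the lower half for the rank-zero twist
    (hlow : MissingLowerBoundAt Wd p)
    -- an upper bound of Kolyvagin's shape over `K`
    (hU : Finite (W.baseChange K).sha → ¬ IsOfFinAddOrder P →
      padicValNat p (Nat.card (W.baseChange K).sha) ≤
        2 * padicValNat p (AddSubgroup.zmultiples P).index) :
    ∃ q : ℚ, shaAn W = (q : ℂ) ∧
      (padicValNat p W.shaOrder : ℤ) ≤ padicValRat p q + 2 * padicValNat p W.tamagawaProduct := by
  have hp2 : p ≠ 2 := by omega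
  have hD0 : (NumberField.discr K : ℚ) ≠ 0 := by exact_mod_cast NumberField.discr_ne_zero K
  haveI hEt : (W.quadraticTwist (NumberField.discr K : ℚ)).IsElliptic :=
    W.isElliptic_quadraticTwist hD0
  -- transports to the minimal twist model
  have hirrd : Wd.HasIrreducibleModPGaloisRep p :=
    X11b.hasIrreducibleModPGaloisRep_twist_model W p K hK.1 hirr Cd hWd
  have htam : padicValNat p Wd.tamagawaProduct = padicValNat p W.tamagawaProduct :=
    X11b.padicValNat_tamagawaProduct_twist_of_heegner W p hp5 K hK hHN Cd hWd
  have hu : padicValRat p (Cd.u : ℚ) = 0 :=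
    padicValRat_u_eq_zero_of_twist_minimal_of_dvd W p K hK hHN hpN Cd hWd
  -- the twist has analytic rank `0`
  have hLt' : (W.quadraticTwist (NumberField.discr K : ℚ)).entireLFunction = Wd.entireLFunction := by
    rw [← hWd, entireLFunction_smul]
  have hLd1 : Wd.entireLFunction 1 ≠ 0 := by rw [← hLt']; exact hLt
  have hrd : Wd.analyticRank = 0 := (Wd.analyticRank_eq_zero_iff_holds (hmod Wd)).2 hLd1
  -- the lower half in print shape
  obtain ⟨qd, hqd, hvqd⟩ :=
    exists_printShape_lower_of_missingLowerBoundAt_rankZero (p := p) Wd hGZK hrd hirrd hlow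
  exact X11b.padicValNat_shaOrder_le_add_of_shaIndexBound W p (W.conductorNorm ℤ) K Dt H ι P hGZ hKo
    hGZK hmod hK hHN hP hp2 hc hμ hr hLt Wd Cd hWd hu htam ⟨qd, hqd, hvqd⟩ hU

end Summit.BirchSwinnertonDyer.Rank1Residual.AdditivePotMult

end
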